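import Literature.Analysis.OperatorTheory.CoerciveFiniteRankInverse
import Literature.Analysis.Calculus.NewtonKantorovichExactInverse
import HarnessLib

/-!
# The assembled a-posteriori existence theorem for `G : E → E*` with `DG(x̄) = coercive − finite rank − small`

`Literature/Analysis/OperatorTheory`; proofs-layer file (one theorem family, no definitions, no named facts).
It COMPOSES the four kernel steps

* (C1) `CoerciveFiniteRankInverse.exists_inverse_of_coercive` (Lax–Milgram with the constant),
* (C2) `…finiteRankPerturbation_inverse` + `…norm_inverse_add_correction_le{,_dual}` (Woodbury + Gram pencil),
* (C3) `…exists_inverse_sub_of_two_norm` (two-norm Neumann step),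
* (C4) `Calculus.existsUnique_zero_of_kantorovich` (Newton–Kantorovich with the exact inverse),

into ONE statement whose hypotheses are exactly the constants an interval-arithmetic certificate prints
(`c, N, Λ_E, Λ_W, K₂, ε, L, η`) together with the identities the MODEL supplies (the splitting
`DG(x̄) u = B u − ∑ ℓᵢ(u) fᵢ − J (R u)`, the adjoint solves `B v zⱼ = ℓⱼ v`, the pivot-space representation
`ℓⱼ(S (J g)) = ⟪aⱼ, g⟫_W`), and whose conclusion is the certificate's sentence "`∃!` zero of `G` in the closed
`E`-ball of radius `r = (1 − √(1 − 2h))/(K L)` about `x̄`, `h = K²Lη`, `K = (c⁻¹ + √Λ_E)/(1 − (K₂ + √Λ_W) ε)`"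
(`existsUnique_zero_of_coercive_finiteRank_chain`).  Sources as in the four files: [Brezis2011] Cor. 5.8,
[Kato1966] III-§4.3 (4.13) / IV-§1.4 Thm. 1.16, [Deuflhard2011] §2.1.1 Thm. 2.1.

The inverse `S` of the coercive part enters as DATA with its three properties (it exists by (C1)); the
capacitance inverse `N` and the pencil bounds refer to the exact `S` (forward solves `S fᵢ`) and the exact
adjoint solves `zⱼ` — in a certificate these hypotheses are discharged by interval enclosures (a-posteriori:
`norm_inverse_sub_le_of_residual`), which is the part that stays outside the kernel.

MOTIVATION (recorded for provenance): this is the logical skeleton of the sheet-ℝ certificate of cell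
ns-blowup, case Z3-SR-CERT (`HOME/profile/cert/impl1/PREREG-SHEET-R-CERT.md` P2–P4): `E = ` odd
`H¹_{L²+ξ²}`, `W = L²_w`, `B = B_λ` (`c = c_λ`), `fᵢ = eᵢ`, `ℓᵢ = ⟨P ·, eᵢ⟩_w/(2L³π)`, `K₂ = 2/c_λ`,
`K_N* = c_λ⁻¹ + √Λ_E`, `K_Nw = K₂ + √Λ_W`, `ε = ε_N`, `L = L_lip`, `η = ‖G(Ω̄)‖_{X*}`.  WHAT THIS IS NOT:
nothing about Navier–Stokes; abstract functional analysis.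
-/

noncomputable section

open Metric Set Matrix Finset
open scoped BigOperators

namespace Literature.Analysis.OperatorTheory

variable {E : Type*} [NormedAddCommGroup E] [InnerProductSpace ℝ E] [CompleteSpace E]
variable {W : Type*} [NormedAddCommGroup W] [InnerProductSpace ℝ W]
variable {ι : Type*} [Fintype ι] [DecidableEq ι]

/-- **Linear part of the chain.**  With the data of (C1)–(C3) — `S` a two-sided inverse of the form-operator
`B : E → E*` with `‖S φ‖ ≤ K₁‖φ‖`; finite-rank data `fᵢ ∈ E*`, `ℓᵢ ∈ E*` with capacitance inverse `N`;
adjoint solves `zⱼ` (`B v zⱼ = ℓⱼ v`) whose Gram pencil bounds the correction by `Λ_E`; a pivot space `W`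
with `J : W → E*`, `‖S (J g)‖ ≤ K₂‖g‖`, representers `aⱼ` (`ℓⱼ(S (J g)) = ⟪aⱼ, g⟫`) whose Gram pencil bounds
the correction by `Λ_W`; a remainder `R : E → W`, `‖R u‖ ≤ ε‖u‖`, with `(K₂ + √Λ_W) ε < 1` — the operator
`D u = B u − ∑ ℓᵢ(u) fᵢ − J (R u)` has a two-sided bounded inverse `T` with
`‖T φ‖ ≤ (K₁ + √Λ_E)/(1 − (K₂ + √Λ_W) ε) · ‖φ‖`.
[cite: Kato1966, IV-§1.4, Thm. 1.16 (with III-§4.3 (4.13))] -/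
theorem exists_inverse_of_coercive_finiteRank_chain {B : E →L[ℝ] E →L[ℝ] ℝ}
    (S : StrongDual ℝ E →L[ℝ] E) (hBS : ∀ φ, B (S φ) = φ) (hSB : ∀ u, S (B u) = u)
    {K₁ : ℝ} (hS : ∀ φ, ‖S φ‖ ≤ K₁ * ‖φ‖)
    (f : ι → StrongDual ℝ E) (ℓ : ι → E →L[ℝ] ℝ) (N : Matrix ι ι ℝ)
    (hN₁ : (1 - capMatrix f (fun i => (ℓ i).comp S)) * N = 1)
    (hN₂ : N * (1 - capMatrix f (fun i => (ℓ i).comp S)) = 1)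
    (z : ι → E) (hz : ∀ j u, B u (z j) = ℓ j u) {ΛE : ℝ} (hΛE : 0 ≤ ΛE)
    (hpE : ∀ w : ι → ℝ, ‖∑ i, (N *ᵥ (Matrix.gram ℝ z *ᵥ w)) i • S (f i)‖ ^ 2 ≤
      ΛE * (w ⬝ᵥ (Matrix.gram ℝ z *ᵥ w)))
    (J : W →L[ℝ] StrongDual ℝ E) {K₂ : ℝ} (hSJ : ∀ g, ‖S (J g)‖ ≤ K₂ * ‖g‖)
    (a : ι → W) (ha : ∀ j g, ℓ j (S (J g)) = inner ℝ (a j) g) {ΛW : ℝ} (hΛW : 0 ≤ ΛW)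
    (hpW : ∀ w : ι → ℝ, ‖∑ i, (N *ᵥ (Matrix.gram ℝ a *ᵥ w)) i • S (f i)‖ ^ 2 ≤
      ΛW * (w ⬝ᵥ (Matrix.gram ℝ a *ᵥ w)))
    (R : E →L[ℝ] W) {ε : ℝ} (hR : ∀ u, ‖R u‖ ≤ ε * ‖u‖) (hε : 0 ≤ ε) (hK₂ : 0 ≤ K₂)
    (hsmall : (K₂ + Real.sqrt ΛW) * ε < 1)
    (D : E →L[ℝ] StrongDual ℝ E) (hD : ∀ u, D u = B u - ∑ i, ℓ i u • f i - J (R u)) :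
    ∃ T : StrongDual ℝ E →L[ℝ] E, (∀ φ, D (T φ) = φ) ∧ (∀ u, T (D u) = u) ∧
      ∀ φ, ‖T φ‖ ≤ (K₁ + Real.sqrt ΛE) / (1 - (K₂ + Real.sqrt ΛW) * ε) * ‖φ‖ := by
  set g : ι → StrongDual ℝ E →L[ℝ] ℝ := fun i => (ℓ i).comp S with hg
  set DN : E →L[ℝ] StrongDual ℝ E := (1 - finiteRank f g).comp (B : E →L[ℝ] StrongDual ℝ E) with hDN
  set TN : StrongDual ℝ E →L[ℝ] E := S.comp (capInverse f g N) with hTN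
  obtain ⟨hDT, hTD⟩ := finiteRankPerturbation_inverse (B : E →L[ℝ] StrongDual ℝ E) S hBS hSB f ℓ N hN₁ hN₂
  have hTN_apply : ∀ y, TN y = S y + ∑ i, (N *ᵥ fun j => ℓ j (S y)) i • S (f i) :=
    fun y => inverse_comp_capInverse_apply S f ℓ N y
  -- (C2) norm bounds on `E*` and on `J(W)`
  have hKs : ∀ φ, ‖TN φ‖ ≤ (K₁ + Real.sqrt ΛE) * ‖φ‖ := fun φ => by
    rw [hTN_apply]
    exact norm_inverse_add_correction_le_dual S hBS hS f ℓ z hz N hΛE hpE φ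
  have hKw : ∀ g' : W, ‖TN (J g')‖ ≤ (K₂ + Real.sqrt ΛW) * ‖g'‖ := fun g' => by
    rw [hTN_apply]
    exact norm_inverse_add_correction_le S f ℓ N a hΛW hpW (J g') g' (hSJ g') (fun j => ha j g')
  -- (C3)
  have hKw0 : 0 ≤ K₂ + Real.sqrt ΛW := add_nonneg hK₂ (Real.sqrt_nonneg _)
  obtain ⟨T, h1, h2, h3⟩ := exists_inverse_sub_of_two_norm DN TN hDT hTD J R hKs hKw hR hKw0 hε hsmall
  -- `D = DN − J ∘ R`
  have hDeq : D = DN - J.comp R := by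
    ext u v
    have h1' : DN u = B u - ∑ i, ℓ i u • f i := by
      rw [hDN]
      exact finiteRankPerturbation_apply (B : E →L[ℝ] StrongDual ℝ E) S hSB f ℓ u
    have h2' : (DN - J.comp R) u = DN u - J (R u) := rfl
    rw [hD u, h2', h1']
  refine ⟨T, fun φ => ?_, fun u => ?_, h3⟩
  · rw [hDeq]; exact h1 φ
  · rw [hDeq]; exact h2 u

/-- **The assembled certificate theorem** (coercive − finite rank − small, then Newton–Kantorovich).  Let
`G : E → E*` be Fréchet differentiable with derivative `G'`, and let `G' x̄ = D` split as in
`exists_inverse_of_coercive_finiteRank_chain` (so that `‖DG(x̄)⁻¹‖ ≤ K := (K₁ + √Λ_E)/(1 − (K₂ + √Λ_W) ε)`);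
let `‖G' x − G' x̄‖ ≤ L‖x − x̄‖` (`L > 0`), `‖G x̄‖ ≤ η` and `2K²Lη < 1`.  Then the closed `E`-ball of radius
`(1 − √(1 − 2K²Lη))/(KL)` about `x̄` contains exactly one zero of `G`.
[cite: Deuflhard2011, §2.1.1 Thm. 2.1 (with `α ≤ Kη`, `ω̄₀ ≤ KL`); Kato1966, IV-§1.4 Thm. 1.16] -/
theorem existsUnique_zero_of_coercive_finiteRank_chain {G : E → StrongDual ℝ E}
    {G' : E → E →L[ℝ] StrongDual ℝ E} {xbar : E} (hG : ∀ x, HasFDerivAt G (G' x) x)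
    {B : E →L[ℝ] E →L[ℝ] ℝ}
    (S : StrongDual ℝ E →L[ℝ] E) (hBS : ∀ φ, B (S φ) = φ) (hSB : ∀ u, S (B u) = u)
    {K₁ : ℝ} (hS : ∀ φ, ‖S φ‖ ≤ K₁ * ‖φ‖)
    (f : ι → StrongDual ℝ E) (ℓ : ι → E →L[ℝ] ℝ) (N : Matrix ι ι ℝ)
    (hN₁ : (1 - capMatrix f (fun i => (ℓ i).comp S)) * N = 1)
    (hN₂ : N * (1 - capMatrix f (fun i => (ℓ i).comp S)) = 1)
    (z : ι → E) (hz : ∀ j u, B u (z j) = ℓ j u) {ΛE : ℝ} (hΛE : 0 ≤ ΛE)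
    (hpE : ∀ w : ι → ℝ, ‖∑ i, (N *ᵥ (Matrix.gram ℝ z *ᵥ w)) i • S (f i)‖ ^ 2 ≤
      ΛE * (w ⬝ᵥ (Matrix.gram ℝ z *ᵥ w)))
    (J : W →L[ℝ] StrongDual ℝ E) {K₂ : ℝ} (hSJ : ∀ g, ‖S (J g)‖ ≤ K₂ * ‖g‖)
    (a : ι → W) (ha : ∀ j g, ℓ j (S (J g)) = inner ℝ (a j) g) {ΛW : ℝ} (hΛW : 0 ≤ ΛW)
    (hpW : ∀ w : ι → ℝ, ‖∑ i, (N *ᵥ (Matrix.gram ℝ a *ᵥ w)) i • S (f i)‖ ^ 2 ≤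
      ΛW * (w ⬝ᵥ (Matrix.gram ℝ a *ᵥ w)))
    (R : E →L[ℝ] W) {ε : ℝ} (hR : ∀ u, ‖R u‖ ≤ ε * ‖u‖) (hε : 0 ≤ ε) (hK₂ : 0 ≤ K₂)
    (hsmall : (K₂ + Real.sqrt ΛW) * ε < 1)
    (hD : ∀ u, G' xbar u = B u - ∑ i, ℓ i u • f i - J (R u))
    {K L η : ℝ} (hK : (K₁ + Real.sqrt ΛE) / (1 - (K₂ + Real.sqrt ΛW) * ε) ≤ K) (hKpos : 0 < K)
    (hL : ∀ x, ‖G' x - G' xbar‖ ≤ L * ‖x - xbar‖) (hLpos : 0 < L) (hη : ‖G xbar‖ ≤ η)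
    (h : 2 * (K ^ 2 * L * η) < 1) :
    ∃ x ∈ closedBall xbar ((1 - Real.sqrt (1 - 2 * (K ^ 2 * L * η))) / (K * L)),
      G x = 0 ∧ ∀ y ∈ closedBall xbar ((1 - Real.sqrt (1 - 2 * (K ^ 2 * L * η))) / (K * L)),
        G y = 0 → y = x := by
  obtain ⟨T, hDT, hTD, hT⟩ := exists_inverse_of_coercive_finiteRank_chain S hBS hSB hS f ℓ N hN₁ hN₂ z hz
    hΛE hpE J hSJ a ha hΛW hpW R hR hε hK₂ hsmall (G' xbar) hD
  -- the exact inverse as a continuous linear equivalence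
  set Φ : E ≃L[ℝ] StrongDual ℝ E :=
    ContinuousLinearEquiv.equivOfInverse (G' xbar) T (fun u => hTD u) (fun φ => hDT φ) with hΦ
  have hΦeq : (Φ : E →L[ℝ] StrongDual ℝ E) = G' xbar := by
    ext u v; rfl
  have hΦsymm : ∀ φ, (Φ.symm : StrongDual ℝ E →L[ℝ] E) φ = T φ := fun φ => rfl
  have hKΦ : ‖(Φ.symm : StrongDual ℝ E →L[ℝ] E)‖ ≤ K := by
    refine ContinuousLinearMap.opNorm_le_bound _ hKpos.le fun φ => ?_
    rw [hΦsymm]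
    exact (hT φ).trans (mul_le_mul_of_nonneg_right hK (norm_nonneg _))
  exact Literature.Analysis.Calculus.existsUnique_zero_of_kantorovich Φ hΦeq hG hKΦ hL hη hKpos hLpos h

end Literature.Analysis.OperatorTheory

end
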